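import Literature.NumberTheory.EllipticCurves.TowerLiftableConnectingProofs
import HarnessLib

/-!
# Saturation is automatic for KERNEL cores into a presented tower without invariants, and the residual image of the
# bottom level condition is then the residual kernel condition (theorems only)

`Proofs` file (theorems only; no definition, no named fact, no instance, no `sorry`).  Companion of
`TowerLiftableConnectingProofs` (x9-p1-w3 g5: the bottom level condition of a UNIFORMLY TORSION tower — Howard's H.5(b) at
the places `v ∈ S ∖ {p}`) for the opposite regime, the places `v ∣ p` of good ORDINARY reduction in the NON-ANOMALOUS case
(cell `pub/bsd-print-x9`, D1 road, memo `HOME/x9-p1-w3/H5B-AT-S-PLAN-w3g5.md` §3; brick (B) of seat `bsd-line-x10b-p1-w8` g2's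
(H5B-P)).  There Howard's local condition `F_𝔮(v)` [B. Howard, Compositio Math. 140 (2004), Def. 3.1.2, arXiv:1202.6340 p. 15
L99–108: `H¹_ord = im (H¹(K_v, Fil_v V_𝔮) → H¹(K_v, V_𝔮))` «propagated to `T_𝔮`»] is, in the tree's currency
(`ZpExtension.eisensteinSelmerStructure`), the level condition `Tower.levelCondition red p C k` of the tower `H_j = H¹(K_v, W_j)`
SATURATED with respect to the STRICT cores `C_j = ker (H¹(K_v, W_j) → H¹(K_v, W_j / Fil_v W_j))` — kernels of `H¹(q_j)` for the
quotient maps `q_j : W_j → G_j := W_j / Fil_v W_j`, which form a morphism of presented towers `(W, f) → (G, g)`.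

**Presentation** (as in `TowerLocalH1LiftExactProofs`): a tower is ONE two-index family `f a b : W a → W b` of continuous
equivariant maps (reductions for `b ≤ a`, the injective `×p^{b-a}` for `a ≤ b`) with the identities `hid/hcomp` and, for
the graded tower `(G, g)`, `hinj/hsurj/hex` (the rows `0 → G ℓ → G (ℓ+n) → G n → 0` are exact) and `hpow`
(`g ℓ (ℓ+n) ∘ g (ℓ+n) ℓ = p^n`).  Results (`F` any field):

* §1 **`Tower.map_apply_eq_zero_of_mem_saturatedFamilies_ker`** — if NO `G a` has a non-zero `Γ_F`-invariant
  (`hH0`; at `v ∣ p`: `H⁰(K_v, gr_v W_a) = 0`, the non-anomalous hypothesis `a_v ≢ 1 (mod p)`), then every saturated family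
  `x` (`x` compatible, `p^a • x_j ∈ C_j` for all `j`) already satisfies `x_j ∈ C_j` for all `j`: its image `z` in the
  `G`-tower is compatible with `p^a • z = 0`, and `H¹(g j (j+a)) (z j) = p^a • z (j+a) = 0` forces `z j = 0` because
  `ker H¹(g j (j+a)) = δ₀(H⁰(F, G a)) = 0` (exactness of `0 → G j → G (j+a) → G a → 0` at `H¹(F, G j)`).  Hence
  `mem_saturatedFamilies_ker_iff_of_invariants_eq_zero` / `mem_levelCondition_ker_iff_of_invariants_eq_zero`:
  the saturated families are exactly the compatible families of core classes.
* §2 `Tower.exists_mem_compatibleFamilies_apply_one_eq` (pure algebra) — in a tower of abelian groups with SURJECTIVE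
  transition maps every element of level `1` is the `1`-component of a compatible family (recursive choice of lifts).
* §3 **`Tower.map_levelCondition_one_eq_ker`** — with, in addition, a sub-tower `(P, h) → (W, f)` (`i_j : P_j → W_j`,
  `q_j ∘ i_j = 0`; at `v ∣ p`: `P_j = Fil_v W_j`), residual presentations `π_P : P 1 → P̄`, `π_W : W 1 → T̄`, `π_G : G 1 → Ḡ`
  compatible with `ī : P̄ → T̄`, `q̄ : T̄ → Ḡ` (`ker H¹(q̄) ⊆ im H¹(ī)`: exactness at `H¹(F, T̄)`), and the LIFTING hypotheses
  «`H¹(F, P (j+1)) → H¹(F, P j)` onto for all `j`» and «`H¹(F, P 1) → H¹(F, P̄)` onto» (at `v ∣ p`: from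
  `H²(K_v, ·) = 0` on the kernels, local duality, non-anomalous again):
  **`H¹(π_W) (levelCondition red p C 1) = ker H¹(q̄)`** — the residual image of the propagated ordinary condition is the
  residual STRICT condition `ker (H¹(K_v, T̄) → H¹(K_v, T̄ / Fil_v T̄)) = im H¹(K_v, Fil_v T̄)` (Howard §3.1 for `T̄ = E[p]`),
  independently of the character `ψ` of the tower — the input of H.5(b) at `v ∣ p` (transport: `Howard2004/TransportStrictProofs`).

Nothing here is specific to elliptic curves; no summit statement is proved; BSD is not proved by any of this.

References: [Howard2004HeegnerKolyvagin] B. Howard, Compositio Math. 140 (2004), Def. 1.1.1/1.1.3 (propagation, `Quot(T)`),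
§1.3 H.5(b), Def. 3.1.2, §3.1, Lemma 3.2.7 (arXiv:1202.6340 p. 5, p. 7 L96–97, p. 15 L56–66 and L99–108, p. 16 L150–160);
[MazurRubinMemoirs2004] Def. 1.1.1, Example 1.1.2; [SerreGaloisCohomology1997] I §2.2 (long exact sequence); [GreenbergLNM1716] §2.
-/

noncomputable section

open CategoryTheory
open scoped ContRepresentation

universe u

namespace Literature.NumberTheory.EllipticCurves

namespace Tower

open Literature.NumberTheory.GaloisRepresentations

variable {F : Type u} [Field F]
variable {W : ℕ → Type u} [∀ j, AddCommGroup (W j)] [∀ j, TopologicalSpace (W j)] [∀ j, DiscreteTopology (W j)]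
variable (ρ : ∀ j, DiscreteGaloisModule F (W j))
variable (f : ∀ a b, (ρ a).toContRepresentation →ⁱL (ρ b).toContRepresentation)
variable {G : ℕ → Type u} [∀ j, AddCommGroup (G j)] [∀ j, TopologicalSpace (G j)] [∀ j, DiscreteTopology (G j)]
variable (ρG : ∀ j, DiscreteGaloisModule F (G j))
variable (g : ∀ a b, (ρG a).toContRepresentation →ⁱL (ρG b).toContRepresentation)
variable (q : ∀ j, (ρ j).toContRepresentation →ⁱL (ρG j).toContRepresentation)

/-! ## §1 Saturation is automatic for kernel cores into a presented tower without invariants -/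

/-- **Saturated ⇒ core, every level.**  Let `q_j : W_j → G_j` be a morphism of towers (`q_j ∘ f (j+1) j = g (j+1) j ∘ q_{j+1}`)
into a tower `(G, g)` with exact rows `0 → G ℓ → G (ℓ+n) → G n → 0`, `g ℓ (ℓ+n) ∘ g (ℓ+n) ℓ = p^n`, and NO non-zero
`Γ_F`-invariants at any level.  If `x` is a saturated family of the `H¹`-tower of `W` for the KERNEL cores `C_j = ker H¹(q_j)`
(`x` compatible, `p^a • x_j ∈ C_j` for all `j`), then `H¹(q_j) (x_j) = 0` for all `j`.  (Howard: at `v ∣ p` non-anomalous,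
the ordinary condition propagated from `V_𝔮` to `T_𝔮` is the strict one — the correction term `H⁰(K_v, gr_v)` of Lemma 3.2.7
vanishes.) [cite: Howard2004HeegnerKolyvagin, Def. 1.1.1, Def. 3.1.2 and Lemma 3.2.7 (arXiv:1202.6340 p. 5 L28–44, p. 15 L99–108, p. 16 L150–160)]
[cite: SerreGaloisCohomology1997, Ch. I §2.2 (exactness at H¹)] -/
theorem map_apply_eq_zero_of_mem_saturatedFamilies_ker
    (hidG : ∀ a (w : G a), g a a w = w)
    (hcompG : ∀ a b c, c ≤ b → b ≤ a → ∀ w : G a, g b c (g a b w) = g a c w)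
    (hinjG : ∀ ℓ n, Function.Injective (g ℓ (ℓ + n)))
    (hsurjG : ∀ ℓ n, Function.Surjective (g (ℓ + n) n))
    (hexG : ∀ ℓ n (y : G (ℓ + n)), g (ℓ + n) n y = 0 ↔ ∃ x, g ℓ (ℓ + n) x = y)
    (p : ℕ) (hpowG : ∀ ℓ n (w : G (ℓ + n)), g ℓ (ℓ + n) (g (ℓ + n) ℓ w) = p ^ n • w)
    (hH0 : ∀ a (w : G a), w ∈ (ρG a).toTopRep.ρ.invariants → w = 0)
    (hq : ∀ j (w : W (j + 1)), q j (f (j + 1) j w) = g (j + 1) j (q (j + 1) w))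
    {x : Π j, galoisCohomology (ρ j) 1}
    (hx : x ∈ saturatedFamilies (H := fun j ↦ galoisCohomology (ρ j) 1)
      (fun j ↦ galoisCohomology.map (f (j + 1) j) 1) p (fun j ↦ (galoisCohomology.map (q j) 1).ker))
    (j : ℕ) : galoisCohomology.map (q j) 1 (x j) = 0 := by
  obtain ⟨hxc, a, ha⟩ := (mem_saturatedFamilies_iff _ p _ x).mp hx
  -- the image `z` of `x` in the `G`-tower is a compatible family
  set z : Π j, galoisCohomology (ρG j) 1 := fun j ↦ galoisCohomology.map (q j) 1 (x j) with hz
  have hzc : z ∈ compatibleFamilies (H := fun j ↦ galoisCohomology (ρG j) 1)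
      (fun j ↦ galoisCohomology.map (g (j + 1) j) 1) := by
    rw [mem_compatibleFamilies_iff]
    intro j
    change galoisCohomology.map (g (j + 1) j) 1 (galoisCohomology.map (q (j + 1)) 1 (x (j + 1))) =
      galoisCohomology.map (q j) 1 (x j)
    rw [galoisCohomology.map_map_of_comp_apply (q (j + 1)) (g (j + 1) j) ((q j).comp (f (j + 1) j))
        (fun w ↦ hq j w),
      ← galoisCohomology.map_map_of_comp_apply (f (j + 1) j) (q j) ((q j).comp (f (j + 1) j)) (fun _ ↦ rfl), hxc j]
  -- `p^a • z (j+a) = 0`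
  have hza : p ^ a • z (j + a) = 0 := by
    have h := ha (j + a)
    rw [AddMonoidHom.mem_ker, map_nsmul] at h
    exact h
  -- `H¹(g j (j+a)) (z j) = H¹(g j (j+a) ∘ g (j+a) j) (z (j+a)) = p^a • z (j+a) = 0`
  have hup : galoisCohomology.map (g j (j + a)) 1 (z j) = 0 := by
    rw [← map_apply_eq_of_mem ρG g hidG hcompG hzc (Nat.le_add_right j a),
      galoisCohomology.map_map_of_comp_apply (g (j + a) j) (g j (j + a))
        (DiscreteGaloisModule.scalarIntertwining _ (DiscreteGaloisModule.isScalarLinear_int _) ((p ^ a : ℕ) : ℤ))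
        (fun w ↦ by rw [DiscreteGaloisModule.scalarIntertwining_apply, natCast_zsmul, hpowG j a w]),
      map_natCastIntertwining_eq_nsmul]
    exact hza
  -- exactness at `H¹(F, G j)` of `0 → G j → G (j+a) → G a → 0`: `z j = δ₀ u` with `u` an invariant of `G a`, `u = 0`
  have hup' : cohomologyMap (TopRep.ofHom ⟨(g j (j + a)).toContinuousLinearMap, (g j (j + a)).isIntertwining'⟩ :
      (ρG j).toTopRep ⟶ (ρG (j + a)).toTopRep) 1 (z j) = 0 := by
    rw [← galoisCohomology.map_eq_cohomologyMap_apply]; exact hup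
  obtain ⟨u, hu⟩ := (isSES_of_exact ρG g hinjG hsurjG hexG j a).exists_δ₀_eq_of_map_one_eq_zero (z j) hup'
  have hu0 : u = 0 := Subtype.ext (hH0 a u.1 u.2)
  rw [hu0, map_zero] at hu
  exact hu.symm

/-- **The saturated families for kernel cores are the compatible families of core classes** (no invariants in the
graded tower): `x ∈ saturatedFamilies red p (ker H¹(q ·)) ↔ x compatible ∧ ∀ j, H¹(q_j) (x_j) = 0`.
[cite: Howard2004HeegnerKolyvagin, Def. 1.1.1 and Def. 3.1.2 (arXiv:1202.6340 p. 5 L28–44, p. 15 L99–108)]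
[cite: MazurRubinMemoirs2004, Def. 1.1.1 and Example 1.1.2] -/
theorem mem_saturatedFamilies_ker_iff_of_invariants_eq_zero
    (hidG : ∀ a (w : G a), g a a w = w)
    (hcompG : ∀ a b c, c ≤ b → b ≤ a → ∀ w : G a, g b c (g a b w) = g a c w)
    (hinjG : ∀ ℓ n, Function.Injective (g ℓ (ℓ + n)))
    (hsurjG : ∀ ℓ n, Function.Surjective (g (ℓ + n) n))
    (hexG : ∀ ℓ n (y : G (ℓ + n)), g (ℓ + n) n y = 0 ↔ ∃ x, g ℓ (ℓ + n) x = y)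
    (p : ℕ) (hpowG : ∀ ℓ n (w : G (ℓ + n)), g ℓ (ℓ + n) (g (ℓ + n) ℓ w) = p ^ n • w)
    (hH0 : ∀ a (w : G a), w ∈ (ρG a).toTopRep.ρ.invariants → w = 0)
    (hq : ∀ j (w : W (j + 1)), q j (f (j + 1) j w) = g (j + 1) j (q (j + 1) w))
    (x : Π j, galoisCohomology (ρ j) 1) :
    x ∈ saturatedFamilies (H := fun j ↦ galoisCohomology (ρ j) 1)
        (fun j ↦ galoisCohomology.map (f (j + 1) j) 1) p (fun j ↦ (galoisCohomology.map (q j) 1).ker) ↔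
      x ∈ compatibleFamilies (H := fun j ↦ galoisCohomology (ρ j) 1) (fun j ↦ galoisCohomology.map (f (j + 1) j) 1) ∧
        ∀ j, galoisCohomology.map (q j) 1 (x j) = 0 := by
  constructor
  · intro hx
    exact ⟨hx.1, fun j ↦ map_apply_eq_zero_of_mem_saturatedFamilies_ker ρ f ρG g q hidG hcompG hinjG hsurjG hexG p hpowG
      hH0 hq hx j⟩
  · rintro ⟨hxc, hxk⟩
    exact (mem_saturatedFamilies_iff _ p _ x).mpr ⟨(mem_compatibleFamilies_iff _ x).mp hxc, 0, fun j ↦ by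
      rw [pow_zero, one_smul]; exact (AddMonoidHom.mem_ker).mpr (hxk j)⟩

/-- **The level conditions for kernel cores are the components of compatible families of core classes** (no
invariants in the graded tower): `y ∈ levelCondition red p (ker H¹(q ·)) k ↔ y = x_k` for a compatible `x` with
`H¹(q_j) (x_j) = 0` for all `j`. [cite: Howard2004HeegnerKolyvagin, Def. 1.1.1/1.1.3 and Def. 3.1.2 (arXiv:1202.6340 p. 5, p. 15 L99–108)]
[cite: MazurRubinMemoirs2004, Example 1.1.2] -/
theorem mem_levelCondition_ker_iff_of_invariants_eq_zero
    (hidG : ∀ a (w : G a), g a a w = w)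
    (hcompG : ∀ a b c, c ≤ b → b ≤ a → ∀ w : G a, g b c (g a b w) = g a c w)
    (hinjG : ∀ ℓ n, Function.Injective (g ℓ (ℓ + n)))
    (hsurjG : ∀ ℓ n, Function.Surjective (g (ℓ + n) n))
    (hexG : ∀ ℓ n (y : G (ℓ + n)), g (ℓ + n) n y = 0 ↔ ∃ x, g ℓ (ℓ + n) x = y)
    (p : ℕ) (hpowG : ∀ ℓ n (w : G (ℓ + n)), g ℓ (ℓ + n) (g (ℓ + n) ℓ w) = p ^ n • w)
    (hH0 : ∀ a (w : G a), w ∈ (ρG a).toTopRep.ρ.invariants → w = 0)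
    (hq : ∀ j (w : W (j + 1)), q j (f (j + 1) j w) = g (j + 1) j (q (j + 1) w))
    (k : ℕ) (y : galoisCohomology (ρ k) 1) :
    y ∈ levelCondition (H := fun j ↦ galoisCohomology (ρ j) 1)
        (fun j ↦ galoisCohomology.map (f (j + 1) j) 1) p (fun j ↦ (galoisCohomology.map (q j) 1).ker) k ↔
      ∃ x ∈ compatibleFamilies (H := fun j ↦ galoisCohomology (ρ j) 1) (fun j ↦ galoisCohomology.map (f (j + 1) j) 1),
        (∀ j, galoisCohomology.map (q j) 1 (x j) = 0) ∧ x k = y := by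
  rw [mem_levelCondition_iff]
  constructor
  · rintro ⟨x, hx, rfl⟩
    obtain ⟨hxc, hxk⟩ := (mem_saturatedFamilies_ker_iff_of_invariants_eq_zero ρ f ρG g q hidG hcompG hinjG hsurjG hexG p
      hpowG hH0 hq x).mp hx
    exact ⟨x, hxc, hxk, rfl⟩
  · rintro ⟨x, hxc, hxk, rfl⟩
    exact ⟨x, (mem_saturatedFamilies_ker_iff_of_invariants_eq_zero ρ f ρG g q hidG hcompG hinjG hsurjG hexG p hpowG hH0
      hq x).mpr ⟨hxc, hxk⟩, rfl⟩

/-! ## §2 Compatible families through a given bottom class when the transition maps are onto -/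

omit [Field F] in
/-- **In a tower of abelian groups with surjective transition maps, every element of level `1` is the `1`-component of a
compatible family** (choose lifts recursively upwards; the `0`-component is the reduction).  For `H_j = H¹(K_v, Fil_v W_j)`
at a non-anomalous `v ∣ p` the transition maps are onto because `H²(K_v, ·)` vanishes on the kernels (local duality).
[cite: SerreGaloisCohomology1997, Ch. I §2.2 (cohomology exact sequence; H¹ → H¹ → H²)] [cite: Howard2004HeegnerKolyvagin, Lemma 3.2.7 (arXiv:1202.6340 p. 16, L150–156: the cokernel is controlled by H²(K_v, Fil_v))] -/
theorem exists_mem_compatibleFamilies_apply_one_eq {H : ℕ → Type u} [∀ j, AddCommGroup (H j)]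
    (red : ∀ j, H (j + 1) →+ H j) (hsurj : ∀ j, Function.Surjective (red (j + 1))) (y₁ : H 1) :
    ∃ x ∈ compatibleFamilies red, x 1 = y₁ := by
  -- `s n ∈ H (n+1)`: `s 0 = y₁`, `s (n+1)` a lift of `s n`
  let s : (n : ℕ) → H (n + 1) := fun n ↦
    Nat.rec (motive := fun n ↦ H (n + 1)) y₁ (fun n yn ↦ Classical.choose (hsurj n yn)) n
  have hs : ∀ n, red (n + 1) (s (n + 1)) = s n := fun n ↦ Classical.choose_spec (hsurj n (s n))
  refine ⟨fun j ↦ match j with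
      | 0 => red 0 y₁
      | j + 1 => s j, ?_, rfl⟩
  rw [mem_compatibleFamilies_iff]
  intro j
  cases j with
  | zero => rfl
  | succ j => exact hs j

/-! ## §3 The residual image of the bottom level condition is the residual kernel condition -/

variable {P : ℕ → Type u} [∀ j, AddCommGroup (P j)] [∀ j, TopologicalSpace (P j)] [∀ j, DiscreteTopology (P j)]
variable (ρP : ∀ j, DiscreteGaloisModule F (P j))
variable (h : ∀ a b, (ρP a).toContRepresentation →ⁱL (ρP b).toContRepresentation)
variable (i : ∀ j, (ρP j).toContRepresentation →ⁱL (ρ j).toContRepresentation)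
variable {Pbar Tbar Gbar : Type u} [AddCommGroup Pbar] [TopologicalSpace Pbar] [DiscreteTopology Pbar]
  [AddCommGroup Tbar] [TopologicalSpace Tbar] [DiscreteTopology Tbar]
  [AddCommGroup Gbar] [TopologicalSpace Gbar] [DiscreteTopology Gbar]
variable {ρPbar : DiscreteGaloisModule F Pbar} {ρTbar : DiscreteGaloisModule F Tbar} {ρGbar : DiscreteGaloisModule F Gbar}
variable (ibar : ρPbar.toContRepresentation →ⁱL ρTbar.toContRepresentation)
  (qbar : ρTbar.toContRepresentation →ⁱL ρGbar.toContRepresentation)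
  (πP : (ρP 1).toContRepresentation →ⁱL ρPbar.toContRepresentation)
  (πW : (ρ 1).toContRepresentation →ⁱL ρTbar.toContRepresentation)
  (πG : (ρG 1).toContRepresentation →ⁱL ρGbar.toContRepresentation)

/-- **The residual image of the bottom level condition is the residual kernel (strict) condition.**  Towers
`(P, h) →i (W, f) →q (G, g)` with `q ∘ i = 0`, `(G, g)` exact with `×p^n`-identities and without invariants (§1), residual
presentations `π_P, π_W, π_G` of level `1` compatible with `ī : P̄ → T̄`, `q̄ : T̄ → Ḡ`, `ker H¹(q̄) ⊆ im H¹(ī)`, and the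
lifting hypotheses «`H¹(F, P (j+1)) → H¹(F, P j)` onto» and «`H¹(F, P 1) → H¹(F, P̄)` onto».  Then
**`H¹(π_W) (levelCondition red p (ker H¹(q ·)) 1) = ker H¹(q̄)`**: `⊆` by §1 and `q̄ ∘ π_W = π_G ∘ q_1`; `⊇` by writing
`ȳ = H¹(ī) (H¹(π_P) y₁)` and lifting `y₁` to a compatible family of the `P`-tower (§2), whose image under `H¹(i ·)` is a
compatible family of core classes through a preimage of `ȳ`.  At `v ∣ p` (non-anomalous): the condition `F_𝔮(v)`
propagated to `T̄ = E[p]` is `ker (H¹(K_v, E[p]) → H¹(K_v, E[p]/Fil_v E[p])) = im H¹(K_v, Fil_v E[p])`, for every `m` and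
every character of the tower. [cite: Howard2004HeegnerKolyvagin, §1.3 H.5(b), Def. 3.1.2 and §3.1 (arXiv:1202.6340 p. 7 L96–97, p. 15 L56–66 and L99–108)]
[cite: GreenbergLNM1716, §2 (the ordinary condition via F⁺)] [cite: SerreGaloisCohomology1997, Ch. I §2.2] -/
theorem map_levelCondition_one_eq_ker
    (hidG : ∀ a (w : G a), g a a w = w)
    (hcompG : ∀ a b c, c ≤ b → b ≤ a → ∀ w : G a, g b c (g a b w) = g a c w)
    (hinjG : ∀ ℓ n, Function.Injective (g ℓ (ℓ + n)))
    (hsurjG : ∀ ℓ n, Function.Surjective (g (ℓ + n) n))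
    (hexG : ∀ ℓ n (y : G (ℓ + n)), g (ℓ + n) n y = 0 ↔ ∃ x, g ℓ (ℓ + n) x = y)
    (p : ℕ) (hpowG : ∀ ℓ n (w : G (ℓ + n)), g ℓ (ℓ + n) (g (ℓ + n) ℓ w) = p ^ n • w)
    (hH0 : ∀ a (w : G a), w ∈ (ρG a).toTopRep.ρ.invariants → w = 0)
    (hq : ∀ j (w : W (j + 1)), q j (f (j + 1) j w) = g (j + 1) j (q (j + 1) w))
    (hi : ∀ j (y : P (j + 1)), i j (h (j + 1) j y) = f (j + 1) j (i (j + 1) y))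
    (hqi : ∀ j (y : P j), q j (i j y) = 0)
    (hπi : ∀ y : P 1, πW (i 1 y) = ibar (πP y)) (hπq : ∀ w : W 1, qbar (πW w) = πG (q 1 w))
    (hexbar : ∀ ybar : galoisCohomology ρTbar 1, galoisCohomology.map qbar 1 ybar = 0 →
      ∃ y : galoisCohomology ρPbar 1, galoisCohomology.map ibar 1 y = ybar)
    (hliftP : ∀ j, Function.Surjective (galoisCohomology.map (h (j + 1 + 1) (j + 1)) 1))
    (hliftbar : Function.Surjective (galoisCohomology.map πP 1)) :
    (levelCondition (H := fun j ↦ galoisCohomology (ρ j) 1) (fun j ↦ galoisCohomology.map (f (j + 1) j) 1) p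
        (fun j ↦ (galoisCohomology.map (q j) 1).ker) 1).map (galoisCohomology.map πW 1) =
      (galoisCohomology.map qbar 1).ker := by
  ext ybar
  constructor
  · -- `⊆`: saturated ⇒ core at level `1` (§1), then `q̄ ∘ π_W = π_G ∘ q_1`
    rintro ⟨y, hy, rfl⟩
    obtain ⟨x, -, hxk, rfl⟩ := (mem_levelCondition_ker_iff_of_invariants_eq_zero ρ f ρG g q hidG hcompG hinjG hsurjG hexG p
      hpowG hH0 hq 1 y).mp hy
    refine (AddMonoidHom.mem_ker).mpr ?_
    rw [galoisCohomology.map_map_of_comp_apply πW qbar (qbar.comp πW) (fun _ ↦ rfl),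
      ← galoisCohomology.map_map_of_comp_apply (q 1) πG (qbar.comp πW) (fun w ↦ hπq w), hxk 1, map_zero]
  · -- `⊇`: lift a preimage along the `P`-tower
    intro hybar
    obtain ⟨ybarP, hybarP⟩ := hexbar ybar ((AddMonoidHom.mem_ker).mp hybar)
    obtain ⟨y₁, hy₁⟩ := hliftbar ybarP
    obtain ⟨y, hyc, hy1⟩ := exists_mem_compatibleFamilies_apply_one_eq
      (H := fun j ↦ galoisCohomology (ρP j) 1) (fun j ↦ galoisCohomology.map (h (j + 1) j) 1) hliftP y₁
    -- the family `x j := H¹(i j) (y j)`: compatible, core classes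
    let x : Π j, galoisCohomology (ρ j) 1 := fun j ↦ galoisCohomology.map (i j) 1 (y j)
    have hxc : x ∈ compatibleFamilies (H := fun j ↦ galoisCohomology (ρ j) 1)
        (fun j ↦ galoisCohomology.map (f (j + 1) j) 1) := by
      rw [mem_compatibleFamilies_iff]
      intro j
      change galoisCohomology.map (f (j + 1) j) 1 (galoisCohomology.map (i (j + 1)) 1 (y (j + 1))) =
        galoisCohomology.map (i j) 1 (y j)
      rw [galoisCohomology.map_map_of_comp_apply (i (j + 1)) (f (j + 1) j) ((i j).comp (h (j + 1) j))
          (fun w ↦ hi j w),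
        ← galoisCohomology.map_map_of_comp_apply (h (j + 1) j) (i j) ((i j).comp (h (j + 1) j)) (fun _ ↦ rfl),
        (mem_compatibleFamilies_iff _ y).mp hyc j]
    have hxk : ∀ j, galoisCohomology.map (q j) 1 (x j) = 0 := fun j ↦ by
      change galoisCohomology.map (q j) 1 (galoisCohomology.map (i j) 1 (y j)) = 0
      rw [galoisCohomology.map_map_of_comp_apply (i j) (q j) ((q j).comp (i j)) (fun _ ↦ rfl)]
      exact galoisCohomology.map_eq_zero_of_apply_eq_zero _ (hqi j) _
    refine ⟨x 1, (mem_levelCondition_ker_iff_of_invariants_eq_zero ρ f ρG g q hidG hcompG hinjG hsurjG hexG p hpowG hH0 hq 1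
      (x 1)).mpr ⟨x, hxc, hxk, rfl⟩, ?_⟩
    change galoisCohomology.map πW 1 (galoisCohomology.map (i 1) 1 (y 1)) = ybar
    rw [galoisCohomology.map_map_of_comp_apply (i 1) πW (ibar.comp πP) (fun w ↦ (hπi w).symm),
      ← galoisCohomology.map_map_of_comp_apply πP ibar (ibar.comp πP) (fun _ ↦ rfl), hy1, hy₁, hybarP]

end Tower

end Literature.NumberTheory.EllipticCurves

end
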